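import Mathlib.Analysis.SpecialFunctions.Pow.Real
import Mathlib.Analysis.SpecialFunctions.Pow.Asymptotics
import Mathlib.Algebra.Order.BigOperators.Group.Finset
import Mathlib.Data.Nat.Log
import Mathlib.Order.Filter.AtTopBot.Basic
import HarnessLib

/-!
# Small value estimates at rational translates (Nguyen–Roy 2016) — proofs, VII: the endgame (Prop. 17 selection, §6 exponents)

Seventh proofs file towards `Literature.NumberTheory.Transcendental.nguyenRoy2016_thm_1` (Nguyen–Roy,
*A small value estimate in dimension two involving translations by rational points*, IJNT 12 (2016)
= arXiv:1412.5163, Theorem 1). Everything here is PROVED; no definitions, no named facts.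

This file formalises the two purely elementary devices of the LAST part of the printed proof (§5,
Proposition 17, and §6, end of Case 2), in the abstract form in which the assembly of Theorem 1
consumes them, so that they are independent of the (still missing) height machinery of §§4–5:

* **The dyadic selection of Proposition 17** (`dyadic_selection_window`, `dyadic_selection`).
  Printed argument (p. 12 of the arXiv text): points `α` of `Z_D` carry an index `t(α) < T ≤ 2ᵏ`
  (the closest `γ_{t(α)}`) and a weight `δ(α) ≤ 0` with `∑_α δ(α) ≤ −2^{k+1} B`; choosing recursively
  a descending chain of dyadic windows `I_k ⊇ I_{k−1} ⊇ ⋯ ⊇ I₀ = {m}` of `2ʲ` consecutive integers,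
  each carrying `∑_{t(α) ∈ I_j} δ(α) ≤ −2^{j+1} B` (keep the heavier half), one gets an integer `m`
  with `∑_{|t(α) − m| < 2ʲ} δ(α) ≤ −2^{j+1} B` for all `j ≤ k`, hence
  `∑_{|t(α) − m| < T*} δ(α) ≤ −T* B` for every `1 ≤ T* ≤ 2ᵏ` (take `2ʲ ≤ T* < 2^{j+1}`), and
  `m = t(α)` for some `α` as soon as `B > 0`. We prove exactly this, for an arbitrary finite set of
  "points" (`Finset ι`), index map `t : ι → ℕ` and weight `δ : ι → ℝ`; `|t − m| < n` is written
  subtraction-free as `t < m + n ∧ m < t + n`.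
* **The exponent bookkeeping closing Case 2 of §6** (`le_of_frequently_rpow_le`,
  `case_two_exponent_contradiction`). Printed argument (p. 15): if for arbitrarily large `D` there
  is `D* ≥ 1` with `350 (D*)^{3+β−3σ} ≥ D^{ν−2}` and `150 D^{1+β−ν} ≥ (D*)^{σ−1}`, then
  `1 + β − ν ≥ 0` and `(3+β−3σ)(1+β−ν) ≥ (σ−1)(ν−2)`; writing `ν = 2+β−σ+δ` the latter is
  `(2+β−2σ)δ ≤ (σ−1)(3−2σ)`, contradicting the hypothesis on `ν` of Theorem 1 (case `σ < 3/2`).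

## References

* [NguyenRoy2016] N. A. V. Nguyen, D. Roy, IJNT 12 (2016) 1273–1293 = arXiv:1412.5163: §5,
  Proposition 17 and its proof (the sets `I_k ⊇ ⋯ ⊇ I₀`, (5.3)); §6, Case 2, last paragraph.
-/

noncomputable section

open Finset Filter

namespace Literature.NumberTheory.Transcendental

namespace NguyenRoy

/-! ### Proposition 17: the dyadic selection -/

/-- **Dyadic selection, window form** (the recursion `I_j ⊇ I_{j-1}` in the proof of Prop. 17): if
the points with index in the window `[a, a + 2ʲ)` have total weight `≤ −2^{j+1} B` (weights `≤ 0`),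
then some `m` in that window satisfies `∑_{|t(α) − m| < 2ⁱ} δ(α) ≤ −2^{i+1} B` for every `i ≤ j`.
[cite: NguyenRoy2016, Proposition 17 (proof)] -/
theorem dyadic_selection_window {ι : Type*} (A : Finset ι) (t : ι → ℕ) (δ : ι → ℝ) (B : ℝ)
    (hδ : ∀ α ∈ A, δ α ≤ 0) :
    ∀ (j a : ℕ), ∑ α ∈ A.filter (fun α => a ≤ t α ∧ t α < a + 2 ^ j), δ α ≤ -(2 ^ (j + 1) * B) →
      ∃ m, a ≤ m ∧ m < a + 2 ^ j ∧ ∀ i ≤ j,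
        ∑ α ∈ A.filter (fun α => t α < m + 2 ^ i ∧ m < t α + 2 ^ i), δ α ≤ -(2 ^ (i + 1) * B) := by
  intro j
  induction j with
  | zero =>
    intro a ha
    refine ⟨a, le_rfl, by simp, fun i hi => ?_⟩
    obtain rfl : i = 0 := Nat.le_zero.mp hi
    have hEq : A.filter (fun α => t α < a + 2 ^ 0 ∧ a < t α + 2 ^ 0) =
        A.filter (fun α => a ≤ t α ∧ t α < a + 2 ^ 0) :=
      Finset.filter_congr fun α _ => by simp only [pow_zero]; omega
    rw [hEq]
    exact ha
  | succ j ih =>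
    intro a ha
    classical
    have h2 : (2 : ℕ) ^ (j + 1) = 2 ^ j + 2 ^ j := by rw [pow_succ, mul_two]
    -- the two halves `S₁ = [a, a + 2^j)`, `S₂ = [a + 2^j, a + 2^(j+1))` of the window
    have hunion : A.filter (fun α => a ≤ t α ∧ t α < a + 2 ^ (j + 1)) =
        A.filter (fun α => a ≤ t α ∧ t α < a + 2 ^ j) ∪
          A.filter (fun α => a + 2 ^ j ≤ t α ∧ t α < (a + 2 ^ j) + 2 ^ j) := by
      rw [← Finset.filter_or]
      refine Finset.filter_congr fun α _ => ?_
      rw [h2]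
      omega
    have hdisj : Disjoint (A.filter (fun α => a ≤ t α ∧ t α < a + 2 ^ j))
        (A.filter (fun α => a + 2 ^ j ≤ t α ∧ t α < (a + 2 ^ j) + 2 ^ j)) :=
      Finset.disjoint_filter.mpr fun α _ h1 => by omega
    have hsum : ∑ α ∈ A.filter (fun α => a ≤ t α ∧ t α < a + 2 ^ j), δ α +
        ∑ α ∈ A.filter (fun α => a + 2 ^ j ≤ t α ∧ t α < (a + 2 ^ j) + 2 ^ j), δ α
          ≤ -(2 ^ (j + 1 + 1) * B) := by
      rw [← Finset.sum_union hdisj, ← hunion]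
      exact ha
    -- one half carries at least half of the (negative) mass
    have hhalf : ∑ α ∈ A.filter (fun α => a ≤ t α ∧ t α < a + 2 ^ j), δ α ≤ -(2 ^ (j + 1) * B) ∨
        ∑ α ∈ A.filter (fun α => a + 2 ^ j ≤ t α ∧ t α < (a + 2 ^ j) + 2 ^ j), δ α
          ≤ -(2 ^ (j + 1) * B) := by
      by_contra hcon
      push Not at hcon
      have : (2 : ℝ) ^ (j + 1 + 1) * B = 2 ^ (j + 1) * B + 2 ^ (j + 1) * B := by ring
      linarith [hcon.1, hcon.2]
    -- the ball of radius `2^(j+1)` around any `m` of the window contains the window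
    have hball : ∀ m, a ≤ m → m < a + 2 ^ (j + 1) →
        ∑ α ∈ A.filter (fun α => t α < m + 2 ^ (j + 1) ∧ m < t α + 2 ^ (j + 1)), δ α
          ≤ -(2 ^ (j + 1 + 1) * B) := by
      intro m hm1 hm2
      refine le_trans (Finset.sum_le_sum_of_subset_of_nonpos' ?_ ?_) ha
      · intro α hα
        simp only [Finset.mem_filter] at hα ⊢
        exact ⟨hα.1, by omega, by omega⟩
      · intro α hα _
        exact hδ α (Finset.mem_filter.mp hα).1
    have finish : ∀ m, a ≤ m → m < a + 2 ^ (j + 1) →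
        (∀ i ≤ j, ∑ α ∈ A.filter (fun α => t α < m + 2 ^ i ∧ m < t α + 2 ^ i), δ α
          ≤ -(2 ^ (i + 1) * B)) →
        ∃ m, a ≤ m ∧ m < a + 2 ^ (j + 1) ∧ ∀ i ≤ j + 1,
          ∑ α ∈ A.filter (fun α => t α < m + 2 ^ i ∧ m < t α + 2 ^ i), δ α
            ≤ -(2 ^ (i + 1) * B) := by
      intro m hm1 hm2 hm
      refine ⟨m, hm1, hm2, fun i hi => ?_⟩
      rcases hi.lt_or_eq with hi' | rfl
      · exact hm i (Nat.lt_succ_iff.mp hi')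
      · exact hball m hm1 hm2
    rcases hhalf with h | h
    · obtain ⟨m, hm1, hm2, hm⟩ := ih a h
      exact finish m hm1 (by omega) hm
    · obtain ⟨m, hm1, hm2, hm⟩ := ih (a + 2 ^ j) h
      exact finish m (by omega) (by omega) hm

/-- **Dyadic selection** (Nguyen–Roy, proof of Proposition 17, abstract form). Let `A` be a finite
set of points `α` with indices `t(α) < 2ᵏ` and weights `δ(α) ≤ 0`, and `B ≥ 0` with
`∑_α δ(α) ≤ −2^{k+1} B`. Then there is `m < 2ᵏ` such that
`∑_{|t(α) − m| < T*} δ(α) ≤ −T* B` for every integer `1 ≤ T* ≤ 2ᵏ`; moreover `m = t(α)` for some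
`α ∈ A` when `B > 0` (this is how the paper gets `0 ≤ m < T`).
[cite: NguyenRoy2016, Proposition 17 (proof, (5.3)–(5.5))] -/
theorem dyadic_selection {ι : Type*} (A : Finset ι) (t : ι → ℕ) (δ : ι → ℝ) {B : ℝ} (hB : 0 ≤ B)
    (hδ : ∀ α ∈ A, δ α ≤ 0) (k : ℕ) (ht : ∀ α ∈ A, t α < 2 ^ k)
    (hsum : ∑ α ∈ A, δ α ≤ -(2 ^ (k + 1) * B)) :
    ∃ m < 2 ^ k, (0 < B → ∃ α ∈ A, t α = m) ∧
      ∀ n : ℕ, 1 ≤ n → n ≤ 2 ^ k →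
        ∑ α ∈ A.filter (fun α => t α < m + n ∧ m < t α + n), δ α ≤ -(n * B) := by
  have h0 : ∑ α ∈ A.filter (fun α => 0 ≤ t α ∧ t α < 0 + 2 ^ k), δ α ≤ -(2 ^ (k + 1) * B) := by
    rw [Finset.filter_true_of_mem]
    · exact hsum
    · intro α hα
      exact ⟨Nat.zero_le _, by simpa using ht α hα⟩
  obtain ⟨m, -, hm2, hm⟩ := dyadic_selection_window A t δ B hδ k 0 h0
  refine ⟨m, by simpa using hm2, fun hB' => ?_, fun n hn1 hn2 => ?_⟩
  · -- `m = t(α)` for some `α`: the ball of radius `1` around `m` has negative mass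
    have h := hm 0 (Nat.zero_le _)
    by_contra hcon
    push Not at hcon
    have hempty : A.filter (fun α => t α < m + 2 ^ 0 ∧ m < t α + 2 ^ 0) = ∅ := by
      refine Finset.filter_eq_empty_iff.mpr fun α hα h' => hcon α hα ?_
      simp only [pow_zero] at h'
      omega
    rw [hempty, Finset.sum_empty] at h
    have : (0 : ℝ) < 2 ^ (0 + 1) * B := by positivity
    linarith
  · -- `2^j ≤ n < 2^(j+1)` with `j ≤ k`
    obtain ⟨j, hj1, hj2⟩ : ∃ j, 2 ^ j ≤ n ∧ n < 2 ^ (j + 1) :=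
      ⟨Nat.log 2 n, Nat.pow_log_le_self 2 (by omega), Nat.lt_pow_succ_log_self (by norm_num) n⟩
    have hkpos : 0 < 2 ^ k := pow_pos (by norm_num) k
    have hjk : j ≤ k := by
      by_contra hcon
      push Not at hcon
      have h3 : 2 ^ (k + 1) ≤ 2 ^ j := Nat.pow_le_pow_right (by norm_num) hcon
      have h4 : (2 : ℕ) ^ (k + 1) = 2 ^ k * 2 := pow_succ 2 k
      omega
    calc ∑ α ∈ A.filter (fun α => t α < m + n ∧ m < t α + n), δ α
        ≤ ∑ α ∈ A.filter (fun α => t α < m + 2 ^ j ∧ m < t α + 2 ^ j), δ α := by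
          refine Finset.sum_le_sum_of_subset_of_nonpos' ?_
            (fun α hα _ => hδ α (Finset.mem_filter.mp hα).1)
          intro α hα
          simp only [Finset.mem_filter] at hα ⊢
          exact ⟨hα.1, by omega, by omega⟩
      _ ≤ -(2 ^ (j + 1) * B) := hm j hjk
      _ ≤ -(n * B) := by
          have : (n : ℝ) ≤ 2 ^ (j + 1) := by exact_mod_cast hj2.le
          nlinarith

/-! ### §6, Case 2: the exponent bookkeeping -/

/-- If `D^a ≤ K D^e` for arbitrarily large real `D`, then `a ≤ e`. [folklore] -/
theorem le_of_frequently_rpow_le {a e K : ℝ} (h : ∀ N : ℝ, ∃ D ≥ N, D ^ a ≤ K * D ^ e) :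
    a ≤ e := by
  by_contra hcon
  push Not at hcon
  have ht : Tendsto (fun D : ℝ => D ^ (a - e)) atTop atTop := tendsto_rpow_atTop (by linarith)
  obtain ⟨N, hN⟩ := Filter.tendsto_atTop_atTop.mp ht (K + 1)
  obtain ⟨D, hD, hle⟩ := h (max N 1)
  have hD1 : 1 ≤ D := le_trans (le_max_right _ _) hD
  have hDN : N ≤ D := le_trans (le_max_left _ _) hD
  have hDpos : 0 < D := by linarith
  have h1 : K + 1 ≤ D ^ (a - e) := hN D hDN
  have h2 : D ^ (a - e) * D ^ e = D ^ a := by rw [← Real.rpow_add hDpos, sub_add_cancel]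
  have h3 : 0 < D ^ e := Real.rpow_pos_of_pos hDpos e
  have h4 : (K + 1) * D ^ e ≤ D ^ a := h2 ▸ mul_le_mul_of_nonneg_right h1 h3.le
  nlinarith

/-- **End of Case 2 of §6** (Nguyen–Roy 2016): under the constraints of Theorem 1 with `σ < 3/2`
(`1 ≤ σ < 3/2`, `β > σ + 1`, `ν > 2 + β − σ + (σ−1)(3−2σ)/(2+β−2σ)`), it is impossible that for
arbitrarily large `D` there be `D* ≥ 1` with `350 (D*)^{3+β−3σ} ≥ D^{ν−2}` and
`150 D^{1+β−ν} ≥ (D*)^{σ−1}` (as printed: these force `1 + β − ν ≥ 0` and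
`(3+β−3σ)(1+β−ν) ≥ (σ−1)(ν−2)`, i.e. `(2+β−2σ)δ ≤ (σ−1)(3−2σ)` for `ν = 2+β−σ+δ`).
[cite: NguyenRoy2016, §6, Case 2 (last paragraph)] -/
theorem case_two_exponent_contradiction {σ β ν : ℝ} (hσ1 : 1 ≤ σ) (hσ : σ < 3 / 2)
    (hβ : σ + 1 < β) (hν : 2 + β - σ + (σ - 1) * (3 - 2 * σ) / (2 + β - 2 * σ) < ν)
    (h : ∀ N : ℝ, ∃ D ≥ N, ∃ Ds : ℝ, 1 ≤ Ds ∧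
      D ^ (ν - 2) ≤ 350 * Ds ^ (3 + β - 3 * σ) ∧ Ds ^ (σ - 1) ≤ 150 * D ^ (1 + β - ν)) :
    False := by
  have hA : 0 < 2 + β - 2 * σ := by linarith
  have hE : 0 < 3 + β - 3 * σ := by linarith
  -- Step 1: `1 + β - ν ≥ 0`
  have step1 : (0 : ℝ) ≤ 1 + β - ν := by
    refine le_of_frequently_rpow_le (K := 150) fun N => ?_
    obtain ⟨D, hD, Ds, hDs, -, h2⟩ := h N
    refine ⟨D, hD, ?_⟩
    rw [Real.rpow_zero]
    calc (1 : ℝ) ≤ Ds ^ (σ - 1) := Real.one_le_rpow hDs (by linarith)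
      _ ≤ 150 * D ^ (1 + β - ν) := h2
  -- Step 2: `(σ - 1)(ν - 2) ≤ (1 + β - ν)(3 + β - 3σ)`
  have step2 : (σ - 1) * (ν - 2) ≤ (1 + β - ν) * (3 + β - 3 * σ) := by
    rcases eq_or_lt_of_le hσ1 with hσeq | hσgt
    · rw [← hσeq]
      have : (0 : ℝ) ≤ (1 + β - ν) * (3 + β - 3 * 1) := mul_nonneg step1 (by linarith)
      linarith
    · have hs : 0 < σ - 1 := by linarith
      have hs' : σ - 1 ≠ 0 := hs.ne'
      set q : ℝ := (3 + β - 3 * σ) / (σ - 1) with hq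
      have hq0 : 0 ≤ q := div_nonneg hE.le hs.le
      have hsq : (σ - 1) * q = 3 + β - 3 * σ := by rw [hq]; field_simp
      have key : ν - 2 ≤ (1 + β - ν) * q := by
        refine le_of_frequently_rpow_le (K := 350 * 150 ^ q) fun N => ?_
        obtain ⟨D, hD, Ds, hDs, h1, h2⟩ := h (max N 1)
        have hD1 : 1 ≤ D := le_trans (le_max_right _ _) hD
        have hDpos : 0 < D := by linarith
        have hDs0 : (0 : ℝ) ≤ Ds := by linarith
        refine ⟨D, le_trans (le_max_left _ _) hD, ?_⟩
        have e1 : Ds ^ (3 + β - 3 * σ) = (Ds ^ (σ - 1)) ^ q := by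
          rw [← Real.rpow_mul hDs0, hsq]
        have e2 : (Ds ^ (σ - 1)) ^ q ≤ (150 * D ^ (1 + β - ν)) ^ q :=
          Real.rpow_le_rpow (Real.rpow_nonneg hDs0 _) h2 hq0
        have e3 : (150 * D ^ (1 + β - ν)) ^ q = 150 ^ q * D ^ ((1 + β - ν) * q) := by
          rw [Real.mul_rpow (by norm_num) (Real.rpow_nonneg hDpos.le _), ← Real.rpow_mul hDpos.le]
        calc D ^ (ν - 2) ≤ 350 * Ds ^ (3 + β - 3 * σ) := h1
          _ ≤ 350 * (150 ^ q * D ^ ((1 + β - ν) * q)) := by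
              rw [e1]
              exact mul_le_mul_of_nonneg_left (e2.trans_eq e3) (by norm_num)
          _ = 350 * 150 ^ q * D ^ ((1 + β - ν) * q) := by ring
      -- multiply `key` by `σ - 1 > 0`
      have key' : (σ - 1) * (ν - 2) ≤ (σ - 1) * ((1 + β - ν) * q) :=
        mul_le_mul_of_nonneg_left key hs.le
      calc (σ - 1) * (ν - 2) ≤ (σ - 1) * ((1 + β - ν) * q) := key'
        _ = (1 + β - ν) * ((σ - 1) * q) := by ring
        _ = (1 + β - ν) * (3 + β - 3 * σ) := by rw [hsq]
  -- Step 3: contradiction with the hypothesis on `ν`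
  have hd : (σ - 1) * (3 - 2 * σ) / (2 + β - 2 * σ) < ν - (2 + β - σ) := by linarith
  rw [div_lt_iff₀ hA] at hd
  have hid : (1 + β - ν) * (3 + β - 3 * σ) - (σ - 1) * (ν - 2) =
      (σ - 1) * (3 - 2 * σ) - (ν - (2 + β - σ)) * (2 + β - 2 * σ) := by ring
  linarith

end NguyenRoy

end Literature.NumberTheory.Transcendental

end
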